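import Summits.QuantumFields.BalabanUV.T4Continuum.Support.NE7SliceTheorem
import Summits.QuantumFields.BalabanUV.T4Continuum.Support.NE3TopRadiusLetters
import Summits.QuantumFields.BalabanUV.T4Continuum.Support.NE3ClassRadiusFamily
import HarnessLib

/-!
# NE7SliceRepresentative — THE SLICE REPRESENTATIVE OF A PAIR IN THE END's CURRENCIES, ONE SMALLNESS HYPOTHESIS (memo ROAD-G102 §3 «what F4e still needs»): at dimension `d+1 ≥ 2`,
# `L ≥ 2`, radius `x = ε∕M²` (`M = L^{k+1}`) for both configurations and a near-representative `‖W(b)⁻¹U′^{u₀}(b) − 1‖ ≤ b̂·M·(ε∕M²)` (gen 94's `10³⁴`), there are k-FREE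
# `ε₂ > 0` and `C_S > 0` (functions of `d, L, card n, b̂`) such that `0 < ε ≤ ε₂` alone gives the slice representative `u⋆` of `NE7SliceTheorem.slice_theorem_curved` with
# `M·‖X⋆‖ ≤ C_S·ε`, `‖h⋆‖ ≤ C_S·ε`, `X⋆ − rightInvW(φ⋆) ∈ 𝒯_E(W)` (the `hslice` binder), together with the tower-class facts `LevelSmall (d+1) L k x`, `LevelSmall (d+1) L (k+1) x`,
# `cruxC·ε < 1`, `curvSum ≤ 2L∕3` and the line `4(3+12(d+1))²·C_S·ε ≤ ρ₀²` that the direct-letter bricks (`NE7SliceCoarseDatumLetter`) consume — every regime line of the slice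
# theorem (θ_P, curvSum, cruxC, the τ-regime, the ceilings `e_E, c_E, δ₀, S`) DISCHARGED by `ε ≤ ε₂`

Cell `pub-balaban`, rung (B)+1 sub-cell t4, lineage `b2b-balaban-t4-ne7-p1`, generation 102 (CRUX PROVER NE7 #1 = OWNER of BINDER row NE7).  Memo `t4/b2b-balaban-t4-ne7-p1-g102/ROAD-G102.md` §3.
By NAME: `NE7SliceTheorem.slice_theorem_curved`; row NE3's radius letters `NE3ClassRadiusFamily.levelSmall_of_small`, `NE3TopRadiusLetters.loopRad_iterate_le_of_levelSmall`,
`NE3LinearisedAverageSup.curvSum_le_of_levelSmall`.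
WHAT ([folklore]; 0 def, 0 sorry).  §1 `mul_le_of_le_mul` (the one-line budget pattern), `levelSmall_pair`, `thetaP_line`, `curvSum_line` (the three class lines from `ε` small).
§2 **`slice_representative`** (statement displayed).
HONEST FRAMING (page 1): real-number bookkeeping over landed theorems; the constants are existential and k-free; nothing of Bałaban's asserted; NOT `hdecomp♭` (the direct letters (S2) are NOT
here), NOT NE7; spine 0∕9; finite T⁴ rung (B)+1 — NOT infinite volume, NOT mass gap, NOT BetaPertH, NOT Clay.  Continuum YM on T⁴ ⇐ BetaPertH ∧ nine spine estimates (0/9 proved); BetaPertH ⇐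
(D1) ∧ (D4) ∧ CAP+tail; G-an2-4 gates asym, D1 and NE2/3/4.
-/

set_option autoImplicit false

open scoped BigOperators Matrix.Norms.L2Operator
open NormedSpace Finset

namespace Summit.QuantumFields.BalabanUV.T4Continuum.NE7SliceRepresentative

open Literature.MathematicalPhysics.QuantumFieldTheory.Balaban1983to89
open B7Prop1Explicit B7Prop2Explicit MatrixLog
open T4AveragingDeficitWall (IsUnitaryCfg IsSkewDir SmallField vary)
open T4AveragingDeficitWallBoundary (IsPeriodicCfg periodBox)
open AveragingDeficitTwoLevelPrep (prop1Radius twoLevelSmall)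
open AveragingDeficitMultiLevelPrep (cavgIter LevelSmall tower)
open BlockAverageVaryHolo (nbRad)
open BlockAverageVaryDisc (rho0 rho0_pos)
open NE3EnergyShapes (IsUnitarySite IsPeriodicSite)
open NE3RightInverseSupLetters (frameC supC)
open NE3HatInvCurlLetters (supCurlC)
open NE3QbarIterCovLiftPrep (cruxC)
open NE3RightInverseSolveLetters (cruxC_nonneg)
open NE3SmoothRightInverseW (rightInvW)
open NE3LinearisedAverageSup (curv curvSum curvSum_le_of_levelSmall)
open NE3TopRadiusLetters (loopRad_iterate_le_of_levelSmall)
open NE3ClassRadiusFamily (levelSmall_of_small)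
open NE7MeanZeroGaugeSliceW (energyBlockLandauW)
open SpreadLift (loopRad)
open NE7SliceIterationState (repLog cornerLog coarseDatum)
open NE7SliceTheorem (slice_theorem_curved)

noncomputable section

variable {d : ℕ} {n : Type*} [Fintype n] [DecidableEq n]

/-! ## §1 The budget pattern and the three class lines -/

omit [Fintype n] [DecidableEq n] in
/-- the budget pattern: `c ≤ r·E`, `ε·E ≤ 1`, `ε, r ≥ 0` ⟹ `c·ε ≤ r`. [folklore] -/
theorem mul_le_of_le_mul {c r ε E : ℝ} (hc : c ≤ r * E) (hεE : ε * E ≤ 1) (hε : 0 ≤ ε) (hr : 0 ≤ r) : c * ε ≤ r := by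
  have h1 : c * ε ≤ r * E * ε := mul_le_mul_of_nonneg_right hc hε
  nlinarith

omit [Fintype n] [DecidableEq n] in
/-- `(L²)^k·(ε∕(L^{k+1})²) = ε∕L²` and `(L²)^{k+1}·(ε∕(L^{k+1})²) = ε`. [folklore] -/
theorem radius_levels {L : ℕ} (hL : 2 ≤ L) (k : ℕ) (ε : ℝ) :
    ((L : ℝ) ^ 2) ^ k * (ε / ((L : ℝ) ^ (k + 1)) ^ 2) = ε / (L : ℝ) ^ 2 ∧ ((L : ℝ) ^ 2) ^ (k + 1) * (ε / ((L : ℝ) ^ (k + 1)) ^ 2) = ε := by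
  have hL0 : (0 : ℝ) < L := by exact_mod_cast (by omega : 0 < L)
  have hM : ((L : ℝ) ^ (k + 1)) ^ 2 = ((L : ℝ) ^ 2) ^ k * (L : ℝ) ^ 2 := by ring
  refine ⟨?_, ?_⟩
  · rw [hM]; field_simp
  · rw [hM]; field_simp; ring

omit [Fintype n] [DecidableEq n] in
/-- **THE TWO `LevelSmall` FACTS** at radius `ε∕M²` from `c_LS·ε ≤ 1∕2`, `2·twoLevelSmall·ε ≤ 1` (`c_LS = 14464(d+1)²(d+4)²L²·8∕3`). [folklore] -/
theorem levelSmall_pair {L : ℕ} (hL : 2 ≤ L) (k : ℕ) {ε : ℝ} (hε : 0 ≤ ε)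
    (h1 : 14464 * ((d : ℝ) + 1) ^ 2 * ((d : ℝ) + 4) ^ 2 * (L : ℝ) ^ 2 * (8 / 3) * ε ≤ 1 / 2) (h2 : 2 * twoLevelSmall d L * ε ≤ 1) :
    LevelSmall d L k (ε / ((L : ℝ) ^ (k + 1)) ^ 2) ∧ LevelSmall d L (k + 1) (ε / ((L : ℝ) ^ (k + 1)) ^ 2) := by
  have hx : 0 ≤ ε / ((L : ℝ) ^ (k + 1)) ^ 2 := by positivity
  obtain ⟨e1, e2⟩ := radius_levels hL k ε
  have hL2r : (2 : ℝ) ≤ L := by exact_mod_cast hL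
  have hL2 : (4 : ℝ) ≤ (L : ℝ) ^ 2 := by nlinarith
  have hεL : ε / (L : ℝ) ^ 2 ≤ ε := by
    rw [div_le_iff₀ (by positivity)]; nlinarith
  have hc0 : (0 : ℝ) ≤ 14464 * ((d : ℝ) + 1) ^ 2 * ((d : ℝ) + 4) ^ 2 * (L : ℝ) ^ 2 := by positivity
  have hT : 0 ≤ twoLevelSmall d L := by unfold twoLevelSmall; positivity
  refine ⟨levelSmall_of_small hL k hx ?_ ?_, levelSmall_of_small hL (k + 1) hx ?_ ?_⟩
  · rw [e1]; nlinarith [mul_le_mul_of_nonneg_left hεL hc0]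
  · rw [e1]; nlinarith [mul_le_mul_of_nonneg_left hεL hT]
  · rw [e2]; linarith
  · rw [e2]; linarith

omit [Fintype n] [DecidableEq n] in
/-- **THE POINCARÉ-PARAMETER LINE** `θ_P ≤ 1∕2` at radius `ε∕M²` from `LevelSmall d L k (ε∕M²)` and `c_θ·ε ≤ 1∕2`, `c_θ = 4d² + 16d·17(d+1)(d+4) + 4d(d−1)` (`d ≥ 1`). [folklore] -/
theorem thetaP_line (hd : 1 ≤ d) {L : ℕ} (hL : 2 ≤ L) (k : ℕ) {ε : ℝ} (hε : 0 ≤ ε) (hs : LevelSmall d L k (ε / ((L : ℝ) ^ (k + 1)) ^ 2))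
    (hθ : (4 * (d : ℝ) ^ 2 + 16 * d * (17 * (((d : ℝ) + 1) * ((d : ℝ) + 4))) + 4 * d * ((d : ℝ) - 1)) * ε ≤ 1 / 2) :
    4 * (d : ℝ) ^ 2 * ((L : ℝ) ^ (k + 1) - 1) ^ 2 * (ε / ((L : ℝ) ^ (k + 1)) ^ 2) + 16 * d * loopRad d L ((prop1Radius d L)^[k] (ε / ((L : ℝ) ^ (k + 1)) ^ 2))
      + 4 * d * ((d : ℝ) - 1) * ((L : ℝ) ^ (k + 1) - 1) ^ 2 * (ε / ((L : ℝ) ^ (k + 1)) ^ 2) ≤ 1 / 2 := by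
  have hM1 : (1 : ℝ) ≤ (L : ℝ) ^ (k + 1) := one_le_pow₀ (by exact_mod_cast (by omega : 1 ≤ L))
  have hM0 : (0 : ℝ) < (L : ℝ) ^ (k + 1) := by positivity
  have hx : 0 ≤ ε / ((L : ℝ) ^ (k + 1)) ^ 2 := by positivity
  have hMx : ((L : ℝ) ^ (k + 1)) ^ 2 * (ε / ((L : ℝ) ^ (k + 1)) ^ 2) = ε := by field_simp
  have hsub : ((L : ℝ) ^ (k + 1) - 1) ^ 2 * (ε / ((L : ℝ) ^ (k + 1)) ^ 2) ≤ ε := by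
    have h1 : ((L : ℝ) ^ (k + 1) - 1) ^ 2 ≤ ((L : ℝ) ^ (k + 1)) ^ 2 := by nlinarith
    calc ((L : ℝ) ^ (k + 1) - 1) ^ 2 * (ε / ((L : ℝ) ^ (k + 1)) ^ 2) ≤ ((L : ℝ) ^ (k + 1)) ^ 2 * (ε / ((L : ℝ) ^ (k + 1)) ^ 2) :=
          mul_le_mul_of_nonneg_right h1 hx
      _ = ε := hMx
  have hloop := loopRad_iterate_le_of_levelSmall (d := d) hL k hx hs
  rw [hMx] at hloop
  have hd0 : (0 : ℝ) ≤ d := Nat.cast_nonneg d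
  have hd1 : (1 : ℝ) ≤ d := by exact_mod_cast hd
  have t1 : 4 * (d : ℝ) ^ 2 * ((L : ℝ) ^ (k + 1) - 1) ^ 2 * (ε / ((L : ℝ) ^ (k + 1)) ^ 2) ≤ 4 * (d : ℝ) ^ 2 * ε := by
    have := mul_le_mul_of_nonneg_left hsub (by positivity : (0 : ℝ) ≤ 4 * (d : ℝ) ^ 2); linarith [this]
  have t2 : 16 * (d : ℝ) * loopRad d L ((prop1Radius d L)^[k] (ε / ((L : ℝ) ^ (k + 1)) ^ 2)) ≤ 16 * d * (17 * (((d : ℝ) + 1) * ((d : ℝ) + 4)) * ε) :=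
    mul_le_mul_of_nonneg_left hloop (by positivity)
  have t3 : 4 * (d : ℝ) * ((d : ℝ) - 1) * ((L : ℝ) ^ (k + 1) - 1) ^ 2 * (ε / ((L : ℝ) ^ (k + 1)) ^ 2) ≤ 4 * d * ((d : ℝ) - 1) * ε := by
    have h0 : (0 : ℝ) ≤ 4 * d * ((d : ℝ) - 1) := by nlinarith
    have := mul_le_mul_of_nonneg_left hsub h0; linarith [this]
  nlinarith [t1, t2, t3]

omit [Fintype n] [DecidableEq n] in
/-- **THE CURVATURE-SUM LINE** `curvSum d L (k+1) (ε∕M²) ≤ 2L∕3` from `LevelSmall` and `C_c·ε ≤ 1∕4`, `C_c` the slope of `curv d L`. [folklore] -/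
theorem curvSum_line {L : ℕ} (hL : 2 ≤ L) (k : ℕ) {ε : ℝ} (hε : 0 ≤ ε) (hs : LevelSmall d L k (ε / ((L : ℝ) ^ (k + 1)) ^ 2))
    (hC : (1250 * ((nbRad d L : ℝ) + L) + 8 * ((d : ℝ) * L) + 2 * L) * (16 * ((d : ℝ) + 1) * ((d : ℝ) + 4) * (L : ℝ) ^ 2) * ε ≤ 1 / 4) :
    curvSum d L (k + 1) (ε / ((L : ℝ) ^ (k + 1)) ^ 2) ≤ 2 / 3 * L := by
  have hx : 0 ≤ ε / ((L : ℝ) ^ (k + 1)) ^ 2 := by positivity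
  have h := curvSum_le_of_levelSmall (d := d) hL k hx hs
  rw [(radius_levels hL k ε).1] at h
  have hL2r : (2 : ℝ) ≤ L := by exact_mod_cast hL
  have hL2 : (4 : ℝ) ≤ (L : ℝ) ^ 2 := by nlinarith
  have hεL : ε / (L : ℝ) ^ 2 ≤ ε := by rw [div_le_iff₀ (by positivity)]; nlinarith
  have hc0 : (0 : ℝ) ≤ (1250 * ((nbRad d L : ℝ) + L) + 8 * ((d : ℝ) * L) + 2 * L) * (16 * ((d : ℝ) + 1) * ((d : ℝ) + 4) * (L : ℝ) ^ 2) := by positivity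
  have hcurv : curv d L (ε / (L : ℝ) ^ 2) ≤ 1 / 4 := by
    unfold curv
    have := mul_le_mul_of_nonneg_left hεL hc0
    nlinarith [this]
  nlinarith [hcurv]

omit [Fintype n] [DecidableEq n] in
set_option maxHeartbeats 400000 in
/-- **THE BUDGET** (pure real arithmetic): from the letters `K, frameC, supC, supCurlC, cruxC, ρ₀, twoLevelSmall`, the dimension `dd`, `b̂` and `ε₁`, ONE constant `E > 0` such that `ε·E ≤ 1`
delivers every numeric line of `slice_theorem_curved`'s regime with `τ := τ₀`, `e_E := ê·ε∕M`, `c_E := ĉ·ε∕M²`, `δ₀ := C_δ·ε∕M`, `S := C_S·ε`. [folklore] -/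
theorem budget {K fC sC sCC crx ρ tls dd bh ε₁ Lr nb : ℝ} (hK : 0 < K) (hfC : 0 ≤ fC) (hsC : 0 ≤ sC) (hsCC : 0 ≤ sCC) (hcrx : 0 ≤ crx) (hρ : 0 < ρ)
    (htls : 0 ≤ tls) (hdd : 1 ≤ dd) (hbh : 0 ≤ bh) (hε₁ : 0 < ε₁) (hLr : 0 ≤ Lr) (hnb : 0 ≤ nb) :
    ∃ E : ℝ, 0 < E ∧ ∃ eh ch Cδ CS τ₀ : ℝ, 0 < CS ∧ 0 < τ₀ ∧ τ₀ ≤ 1 ∧ 30000 * dd * τ₀ ≤ 1 ∧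
      3000000 * (1 + 16 * K) * (1 + dd) ^ 3 * (1 + fC) * (1 + sC + sCC) * τ₀ ≤ 1 / 2 ∧
      eh = 2 * bh * (1 + 2 * sC * (3 + 12 * dd)) ∧ ch = 2 + 192 * bh ^ 2 + 4 * sCC * (3 + 12 * dd) * bh ∧
      Cδ = eh * (1 + fC + 8 * K * fC + 16 * K * dd) + 2 * K * ch ∧ CS = 2 * bh + 24 * dd * Cδ ∧
      ∀ ε : ℝ, 0 < ε → ε * E ≤ 1 →
        ε ≤ 1 ∧ ε ≤ ε₁ ∧ 64 * bh * ε ≤ 1 ∧ 14464 * (dd + 1) ^ 2 * (dd + 4) ^ 2 * Lr ^ 2 * (8 / 3) * ε ≤ 1 / 2 ∧ 2 * tls * ε ≤ 1 ∧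
        (4 * dd ^ 2 + 16 * dd * (17 * ((dd + 1) * (dd + 4))) + 4 * dd * (dd - 1)) * ε ≤ 1 / 2 ∧
        (1250 * (nb + Lr) + 8 * (dd * Lr) + 2 * Lr) * (16 * (dd + 1) * (dd + 4) * Lr ^ 2) * ε ≤ 1 / 4 ∧ crx * ε ≤ 1 / 2 ∧
        6 * dd * Cδ * ε ≤ 1 / 10000 ∧ Cδ * ε ≤ τ₀ ∧ CS * ε ≤ 1 / 10000 ∧ CS * ε ≤ τ₀ ∧ ε ≤ τ₀ ∧ 4 * (3 + 12 * dd) ^ 2 * CS * ε ≤ ρ ^ 2 := by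
  obtain ⟨X₀, hX₀⟩ : ∃ X₀ : ℝ, X₀ = 3000000 * (1 + 16 * K) * (1 + dd) ^ 3 * (1 + fC) * (1 + sC + sCC) := ⟨_, rfl⟩
  have hX₀0 : 0 ≤ X₀ := by rw [hX₀]; positivity
  obtain ⟨τ₀, hτ₀⟩ : ∃ τ₀ : ℝ, τ₀ = 1 / (30000 * dd + 2 * X₀ + 1) := ⟨_, rfl⟩
  have hden : 0 < 30000 * dd + 2 * X₀ + 1 := by positivity
  have hτ₀0 : 0 < τ₀ := by rw [hτ₀]; positivity
  have hτ₀d : τ₀ * (30000 * dd + 2 * X₀ + 1) = 1 := by rw [hτ₀]; field_simp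
  have hτ₀1 : τ₀ ≤ 1 := by nlinarith
  have hτ₀s : 30000 * dd * τ₀ ≤ 1 := by nlinarith
  have hτ₀C : X₀ * τ₀ ≤ 1 / 2 := by nlinarith
  obtain ⟨eh, heh⟩ : ∃ eh : ℝ, eh = 2 * bh * (1 + 2 * sC * (3 + 12 * dd)) := ⟨_, rfl⟩
  have heh0 : 0 ≤ eh := by rw [heh]; positivity
  obtain ⟨ch, hch⟩ : ∃ ch : ℝ, ch = 2 + 192 * bh ^ 2 + 4 * sCC * (3 + 12 * dd) * bh := ⟨_, rfl⟩
  have hch2 : 2 ≤ ch := by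
    have : 0 ≤ 192 * bh ^ 2 + 4 * sCC * (3 + 12 * dd) * bh := by positivity
    rw [hch]; linarith
  obtain ⟨Cδ, hCδ⟩ : ∃ Cδ : ℝ, Cδ = eh * (1 + fC + 8 * K * fC + 16 * K * dd) + 2 * K * ch := ⟨_, rfl⟩
  have hCδK : 4 * K ≤ Cδ := by
    have h1 : 0 ≤ eh * (1 + fC + 8 * K * fC + 16 * K * dd) := by positivity
    have h2 : 2 * K * 2 ≤ 2 * K * ch := mul_le_mul_of_nonneg_left hch2 (by positivity)
    rw [hCδ]; linarith
  have hCδ0 : 0 < Cδ := by linarith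
  obtain ⟨CS, hCS⟩ : ∃ CS : ℝ, CS = 2 * bh + 24 * dd * Cδ := ⟨_, rfl⟩
  have hCSpos : 0 < CS := by rw [hCS]; positivity
  obtain ⟨cθ, hcθ⟩ : ∃ cθ : ℝ, cθ = 4 * dd ^ 2 + 16 * dd * (17 * ((dd + 1) * (dd + 4))) + 4 * dd * (dd - 1) := ⟨_, rfl⟩
  have hcθ0 : 0 ≤ cθ := by
    have : 0 ≤ dd - 1 := by linarith
    rw [hcθ]; positivity
  obtain ⟨cLS, hcLS⟩ : ∃ cLS : ℝ, cLS = 14464 * (dd + 1) ^ 2 * (dd + 4) ^ 2 * Lr ^ 2 * (8 / 3) := ⟨_, rfl⟩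
  have hcLS0 : 0 ≤ cLS := by rw [hcLS]; positivity
  obtain ⟨Cc, hCc⟩ : ∃ Cc : ℝ, Cc = (1250 * (nb + Lr) + 8 * (dd * Lr) + 2 * Lr) * (16 * (dd + 1) * (dd + 4) * Lr ^ 2) := ⟨_, rfl⟩
  have hCc0 : 0 ≤ Cc := by rw [hCc]; positivity
  obtain ⟨A8, hA8⟩ : ∃ A8 : ℝ, A8 = (Cδ + CS + 1) / τ₀ := ⟨_, rfl⟩
  have hA80 : 0 ≤ A8 := by rw [hA8]; positivity
  have hA8m : A8 * τ₀ = Cδ + CS + 1 := by rw [hA8]; field_simp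
  obtain ⟨A9, hA9⟩ : ∃ A9 : ℝ, A9 = 4 * (3 + 12 * dd) ^ 2 * CS / ρ ^ 2 := ⟨_, rfl⟩
  have hA90 : 0 ≤ A9 := by rw [hA9]; positivity
  have hA9m : A9 * ρ ^ 2 = 4 * (3 + 12 * dd) ^ 2 * CS := by rw [hA9]; field_simp
  obtain ⟨A10, hA10⟩ : ∃ A10 : ℝ, A10 = 1 / ε₁ := ⟨_, rfl⟩
  have hA100 : 0 ≤ A10 := by rw [hA10]; positivity
  have hA10m : A10 * ε₁ = 1 := by rw [hA10]; field_simp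
  obtain ⟨E, hE⟩ : ∃ E : ℝ, E = 1 + 64 * bh + 2 * cLS + 2 * tls + 2 * cθ + 4 * Cc + 2 * crx + 10000 * (6 * dd * Cδ + CS) + A8 + A9 + A10 := ⟨_, rfl⟩
  have hE1 : 1 ≤ E := by rw [hE]; linarith [hCδ0.le, hCSpos.le, mul_nonneg (by norm_num : (0:ℝ) ≤ 6) (mul_nonneg (by linarith : 0 ≤ dd) hCδ0.le)]
  refine ⟨E, by linarith, eh, ch, Cδ, CS, τ₀, hCSpos, hτ₀0, hτ₀1, hτ₀s, by rw [← hX₀]; exact hτ₀C, heh, hch, hCδ, hCS, fun ε hε hεE => ?_⟩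
  have hε0 : 0 ≤ ε := hε.le
  have hdd0 : 0 ≤ dd := by linarith
  have hddC : 0 ≤ 6 * dd * Cδ := by positivity
  have hsum : ε * E = ε + 64 * bh * ε + 2 * cLS * ε + 2 * tls * ε + 2 * cθ * ε + 4 * Cc * ε + 2 * crx * ε + 10000 * (6 * dd * Cδ + CS) * ε
      + A8 * ε + A9 * ε + A10 * ε := by rw [hE]; ring
  have p1 : 0 ≤ 64 * bh * ε := by positivity
  have p2 : 0 ≤ 2 * cLS * ε := by positivity
  have p3 : 0 ≤ 2 * tls * ε := by positivity
  have p4 : 0 ≤ 2 * cθ * ε := by positivity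
  have p5 : 0 ≤ 4 * Cc * ε := by positivity
  have p6 : 0 ≤ 2 * crx * ε := by positivity
  have p7 : 0 ≤ 10000 * (6 * dd * Cδ + CS) * ε := by have := hCSpos.le; positivity
  have p8 : 0 ≤ A8 * ε := by positivity
  have p9 : 0 ≤ A9 * ε + A10 * ε := by positivity
  have s1 : 64 * bh * ε ≤ 1 := by linarith
  have s3 : 2 * tls * ε ≤ 1 := by linarith
  have s7 : 10000 * (6 * dd * Cδ + CS) * ε ≤ 1 := by linarith
  have s8 : A8 * ε ≤ 1 := by linarith
  have s9 : A9 * ε ≤ 1 := by linarith [mul_nonneg hA100 hε0]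
  have s10 : A10 * ε ≤ 1 := by linarith [mul_nonneg hA90 hε0]
  have l1 : ε ≤ 1 := by linarith
  have s2 : 2 * cLS * ε ≤ 1 := by linarith
  have s4 : 2 * cθ * ε ≤ 1 := by linarith
  have s5 : 4 * Cc * ε ≤ 1 := by linarith
  have s6 : 2 * crx * ε ≤ 1 := by linarith
  have hA10pos : 0 < A10 := by rw [hA10]; positivity
  have l10 : ε ≤ ε₁ := le_of_mul_le_mul_left (by linarith only [hA10m, s10]) hA10pos
  have l8 : (Cδ + CS + 1) * ε ≤ τ₀ := by
    calc (Cδ + CS + 1) * ε = (A8 * ε) * τ₀ := by rw [← hA8m]; ring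
      _ ≤ 1 * τ₀ := mul_le_mul_of_nonneg_right s8 hτ₀0.le
      _ = τ₀ := one_mul _
  have l9 : 4 * (3 + 12 * dd) ^ 2 * CS * ε ≤ ρ ^ 2 := by
    calc 4 * (3 + 12 * dd) ^ 2 * CS * ε = (A9 * ε) * ρ ^ 2 := by rw [← hA9m]; ring
      _ ≤ 1 * ρ ^ 2 := mul_le_mul_of_nonneg_right s9 (by positivity)
      _ = ρ ^ 2 := one_mul _
  have q1 : 0 ≤ CS * ε := mul_nonneg hCSpos.le hε0
  have q2 : 0 ≤ Cδ * ε := mul_nonneg hCδ0.le hε0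
  have q3 : 0 ≤ dd * (Cδ * ε) := mul_nonneg hdd0 q2
  have s7' : 10000 * (6 * (dd * (Cδ * ε))) + 10000 * (CS * ε) ≤ 1 := by linarith only [s7]
  refine ⟨l1, l10, s1, ?_, s3, ?_, ?_, by linarith only [s6], ?_, ?_, ?_, ?_, ?_, l9⟩
  · rw [← hcLS]; linarith only [s2]
  · rw [← hcθ]; linarith only [s4]
  · rw [← hCc]; linarith only [s5]
  · have : 6 * dd * Cδ * ε = 6 * (dd * (Cδ * ε)) := by ring
    rw [this]; linarith only [s7', q1, q3]
  · linarith only [l8, q1, hε0]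
  · linarith only [s7', q1, q3]
  · linarith only [l8, q2, hε0]
  · have hd1 : (1 : ℝ) * (Cδ * ε) ≤ dd * (Cδ * ε) := mul_le_mul_of_nonneg_right hdd q2
    linarith only [l8, q1, q2, hd1, hε0]

/-! ## §2 The slice representative, one smallness hypothesis -/

set_option maxHeartbeats 400000 in
/-- **THE SLICE REPRESENTATIVE OF A PAIR, ONE SMALLNESS HYPOTHESIS** (dimension `d+1 ≥ 2`, `L ≥ 2`, `b̂ ≥ 0`): `∃ ε₂ > 0, ∃ C_S > 0` (k-free; functions of `d, L, card n, b̂`) such that for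
every level `k`, torus parameter `N`, unitary `(tower L N (k+1))`-periodic `W`, `U′` with `SmallField W (ε∕M²)`, `SmallField U′ (ε∕M²)`, `0 < ε ≤ ε₂`, and every unitary `(tower)`-periodic
corner-trivial `u₀` with `‖W(b)⁻¹U′^{u₀}(b) − 1‖ ≤ b̂·M·(ε∕M²)`: the class facts `LevelSmall (d+1) L k (ε∕M²)`, `LevelSmall (d+1) L (k+1) (ε∕M²)`, `cruxC·(M²·(ε∕M²)) < 1`,
`curvSum (d+1) L (k+1) (ε∕M²) ≤ 2L∕3`, the line `4(3+12(d+1))²·M·(C_S·ε∕M) ≤ ρ₀²`, and a unitary `(tower)`-periodic `u⋆` with the chart `U′^{u⋆} = W·e^{X(u⋆)}`, `M·‖X(u⋆)‖ ≤ C_S·ε`,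
corners `u⋆(M•z) = e^{h(u⋆) z}` with `‖h(u⋆)‖ ≤ C_S·ε`, and THE SLICE CONDITION in the `hslice` binder shape of `NE7DecompOfDirectLettersSlice.decomp_of_directLetters_coarse`
(`X₀ := repLog W U′ u⋆`, `φ := coarseDatum L k W U′ u⋆`, every proof argument of `rightInvW`). [folklore] -/
theorem slice_representative [Nonempty n] (hd : 1 ≤ d) {L : ℕ} (hL : 2 ≤ L) {bh : ℝ} (hbh : 0 ≤ bh) :
    ∃ ε₂ : ℝ, 0 < ε₂ ∧ ∃ CS : ℝ, 0 < CS ∧ ∀ (k N : ℕ) [NeZero N] (W U' : Site (d + 1) → Fin (d + 1) → (Matrix n n ℂ)ˣ) (ε : ℝ),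
      0 < ε → ε ≤ ε₂ → IsUnitaryCfg W → IsPeriodicCfg W ((tower L N (k + 1) : ℕ) : ℤ) → SmallField W (ε / ((L : ℝ) ^ (k + 1)) ^ 2) →
      IsUnitaryCfg U' → IsPeriodicCfg U' ((tower L N (k + 1) : ℕ) : ℤ) → SmallField U' (ε / ((L : ℝ) ^ (k + 1)) ^ 2) →
      ∀ {u₀ : Site (d + 1) → (Matrix n n ℂ)ˣ}, IsUnitarySite u₀ → IsPeriodicSite u₀ ((tower L N (k + 1) : ℕ) : ℤ) → (∀ z : Site (d + 1), u₀ (((L : ℤ) ^ (k + 1)) • z) = 1) →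
      (∀ (y : Site (d + 1)) (κ : Fin (d + 1)), ‖(((W y κ)⁻¹ * gaugeAct u₀ U' y κ : (Matrix n n ℂ)ˣ) : Matrix n n ℂ) - 1‖ ≤ bh * (L : ℝ) ^ (k + 1) * (ε / ((L : ℝ) ^ (k + 1)) ^ 2)) →
      LevelSmall (d + 1) L k (ε / ((L : ℝ) ^ (k + 1)) ^ 2) ∧ LevelSmall (d + 1) L (k + 1) (ε / ((L : ℝ) ^ (k + 1)) ^ 2) ∧
      cruxC (d + 1) L * (((L : ℝ) ^ (k + 1)) ^ 2 * (ε / ((L : ℝ) ^ (k + 1)) ^ 2)) < 1 ∧ curvSum (d + 1) L (k + 1) (ε / ((L : ℝ) ^ (k + 1)) ^ 2) ≤ 2 / 3 * L ∧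
      4 * (3 + 12 * ((d + 1 : ℕ) : ℝ)) ^ 2 * (L : ℝ) ^ (k + 1) * (CS * ε / (L : ℝ) ^ (k + 1)) ≤ rho0 (d + 1) L ^ 2 ∧
      ∃ ustar : Site (d + 1) → (Matrix n n ℂ)ˣ, IsUnitarySite ustar ∧ IsPeriodicSite ustar ((tower L N (k + 1) : ℕ) : ℤ) ∧
        gaugeAct ustar U' = vary W (repLog W U' ustar) 1 ∧
        (∀ (y : Site (d + 1)) (κ : Fin (d + 1)), (L : ℝ) ^ (k + 1) * ‖repLog W U' ustar y κ‖ ≤ CS * ε) ∧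
        (∀ z : Site (d + 1), ((ustar (((L : ℤ) ^ (k + 1)) • z) : (Matrix n n ℂ)ˣ) : Matrix n n ℂ) = exp (cornerLog L k ustar z)) ∧
        (∀ z : Site (d + 1), ‖cornerLog L k ustar z‖ ≤ CS * ε) ∧
        (∀ (hWu' : IsUnitaryCfg W) (hx' : 0 ≤ ε / ((L : ℝ) ^ (k + 1)) ^ 2) (hs' : LevelSmall (d + 1) L k (ε / ((L : ℝ) ^ (k + 1)) ^ 2))
            (hWx' : SmallField W (ε / ((L : ℝ) ^ (k + 1)) ^ 2)) (hθ' : cruxC (d + 1) L * (((L : ℝ) ^ (k + 1)) ^ 2 * (ε / ((L : ℝ) ^ (k + 1)) ^ 2)) < 1)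
            (hφ : IsSkewDir (coarseDatum L k W U' ustar)),
          (fun y μ => repLog W U' ustar y μ - rightInvW hL k hWu' hx' hs' hWx' N hθ' hφ y μ) ∈ energyBlockLandauW (d := d + 1) (n := n) L N (k + 1) W) := by
  obtain ⟨K, hK, ε₁, hε₁, hcurved⟩ := slice_theorem_curved (n := n) hd hL
  have hL1 : 1 ≤ L := by omega
  have hL2r : (2 : ℝ) ≤ L := by exact_mod_cast hL
  have hdd1 : (1 : ℝ) ≤ ((d + 1 : ℕ) : ℝ) := by exact_mod_cast (by omega : 1 ≤ d + 1)
  have hfC : 0 ≤ frameC (d + 1) L := by unfold frameC; positivity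
  have hsC : 0 ≤ supC (d + 1) L := by
    unfold supC NE3RightInverseSupLetters.corrC NE3RightInverseSupLetters.frameC; have := NE3QbarIterCovLiftPrep.liftC_nonneg (d + 1); positivity
  have hsCC : 0 ≤ supCurlC (d + 1) L := by
    unfold supCurlC NE3RightInverseSupLetters.frameC; have := NE3QbarIterCovLiftPrep.liftC_nonneg (d + 1); positivity
  have hcrux : 0 ≤ cruxC (d + 1) L := cruxC_nonneg (d + 1) L
  have hρ : 0 < rho0 (d + 1) L := rho0_pos (d := d + 1) hL1
  have hT : 0 ≤ twoLevelSmall (d + 1) L := by unfold twoLevelSmall; positivity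
  obtain ⟨E, hE0, eh, ch, Cδ, CS, τ₀, hCSpos, hτ₀0, hτ₀1, hτ₀s, hτ₀C, heh, hch, hCδ, hCS, hbud⟩ :=
    budget (K := K) (fC := frameC (d + 1) L) (sC := supC (d + 1) L) (sCC := supCurlC (d + 1) L) (crx := cruxC (d + 1) L) (ρ := rho0 (d + 1) L)
      (tls := twoLevelSmall (d + 1) L) (dd := ((d + 1 : ℕ) : ℝ)) (bh := bh) (ε₁ := ε₁) (Lr := (L : ℝ)) (nb := (nbRad (d + 1) L : ℝ))
      hK hfC hsC hsCC hcrux hρ hT hdd1 hbh hε₁ (by positivity) (by positivity)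
  refine ⟨1 / E, by positivity, CS, hCSpos, ?_⟩
  intro k N _ W U' ε hε hεE hWu hWP hWx hU'u hU'P hU'x u₀ hu₀ hu₀P hpin hb
  have hε0 : 0 ≤ ε := hε.le
  have hεE1 : ε * E ≤ 1 := by rwa [le_div_iff₀ hE0] at hεE
  obtain ⟨hε1', hεε₁, hb64', hls1, hls2, hθline, hCcline, hcrxline, hδmaxline, hCδτ, hS4, hSτ, hετ, hρl⟩ := hbud ε hε hεE1
  have hLpos : (0 : ℝ) < L := by exact_mod_cast (by omega : 0 < L)
  have hM0 : (0 : ℝ) < (L : ℝ) ^ (k + 1) := pow_pos hLpos _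
  have hM1 : (1 : ℝ) ≤ (L : ℝ) ^ (k + 1) := one_le_pow₀ (by linarith only [hL2r])
  have hx : 0 ≤ ε / ((L : ℝ) ^ (k + 1)) ^ 2 := div_nonneg hε0 (pow_nonneg hM0.le 2)
  have hMx : ((L : ℝ) ^ (k + 1)) ^ 2 * (ε / ((L : ℝ) ^ (k + 1)) ^ 2) = ε := by field_simp
  obtain ⟨hsk, hsk1⟩ := levelSmall_pair (d := d + 1) hL k hε0 hls1 hls2
  have hθc : cruxC (d + 1) L * (((L : ℝ) ^ (k + 1)) ^ 2 * (ε / ((L : ℝ) ^ (k + 1)) ^ 2)) ≤ 1 / 2 := by rw [hMx]; exact hcrxline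
  have hθ : cruxC (d + 1) L * (((L : ℝ) ^ (k + 1)) ^ 2 * (ε / ((L : ℝ) ^ (k + 1)) ^ 2)) < 1 := hθc.trans_lt (by norm_num)
  have hθP := thetaP_line (d := d + 1) (by omega) hL k hε0 hsk hθline
  have hA := curvSum_line (d := d + 1) hL k hε0 hsk hCcline
  have hρline : 4 * (3 + 12 * ((d + 1 : ℕ) : ℝ)) ^ 2 * (L : ℝ) ^ (k + 1) * (CS * ε / (L : ℝ) ^ (k + 1)) ≤ rho0 (d + 1) L ^ 2 := by
    have e : 4 * (3 + 12 * ((d + 1 : ℕ) : ℝ)) ^ 2 * (L : ℝ) ^ (k + 1) * (CS * ε / (L : ℝ) ^ (k + 1)) = 4 * (3 + 12 * ((d + 1 : ℕ) : ℝ)) ^ 2 * CS * ε := by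
      field_simp
    rw [e]; exact hρl
  have hbM : bh * (L : ℝ) ^ (k + 1) * (ε / ((L : ℝ) ^ (k + 1)) ^ 2) = bh * ε / (L : ℝ) ^ (k + 1) := by field_simp
  have hb' : ∀ (y : Site (d + 1)) (κ : Fin (d + 1)), ‖(((W y κ)⁻¹ * gaugeAct u₀ U' y κ : (Matrix n n ℂ)ˣ) : Matrix n n ℂ) - 1‖ ≤ bh * ε / (L : ℝ) ^ (k + 1) :=
    fun y κ => (hb y κ).trans (le_of_eq hbM)
  have hbε : bh * ε / (L : ℝ) ^ (k + 1) ≤ bh * ε := div_le_self (mul_nonneg hbh hε0) hM1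
  have hb64 : bh * ε / (L : ℝ) ^ (k + 1) ≤ 1 / 64 := by linarith only [hbε, hb64']
  have h1θ : 1 / 2 ≤ 1 - cruxC (d + 1) L * (((L : ℝ) ^ (k + 1)) ^ 2 * (ε / ((L : ℝ) ^ (k + 1)) ^ 2)) := by linarith only [hθc]
  have h1θ0 : 0 < 1 - cruxC (d + 1) L * (((L : ℝ) ^ (k + 1)) ^ 2 * (ε / ((L : ℝ) ^ (k + 1)) ^ 2)) := by linarith only [hθc]
  have hQ : (3 + 12 * ((d + 1 : ℕ) : ℝ)) * (L : ℝ) ^ (k + 1) * (2 * (bh * ε / (L : ℝ) ^ (k + 1))) = 2 * (3 + 12 * ((d + 1 : ℕ) : ℝ)) * bh * ε := by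
    field_simp
  have hdd0 : (0 : ℝ) ≤ ((d + 1 : ℕ) : ℝ) := Nat.cast_nonneg _
  have hQ0 : 0 ≤ 2 * (3 + 12 * ((d + 1 : ℕ) : ℝ)) * bh * ε :=
    mul_nonneg (mul_nonneg (mul_nonneg (by norm_num) (by linarith only [hdd0])) hbh) hε0
  have heE : 2 * (bh * ε / (L : ℝ) ^ (k + 1)) + supC (d + 1) L / ((L : ℝ) ^ (k + 1) * (1 - cruxC (d + 1) L * (((L : ℝ) ^ (k + 1)) ^ 2 * (ε / ((L : ℝ) ^ (k + 1)) ^ 2))))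
        * ((3 + 12 * ((d + 1 : ℕ) : ℝ)) * (L : ℝ) ^ (k + 1) * (2 * (bh * ε / (L : ℝ) ^ (k + 1)))) ≤ eh * ε / (L : ℝ) ^ (k + 1) := by
    have hfrac : supC (d + 1) L / ((L : ℝ) ^ (k + 1) * (1 - cruxC (d + 1) L * (((L : ℝ) ^ (k + 1)) ^ 2 * (ε / ((L : ℝ) ^ (k + 1)) ^ 2))))
        ≤ supC (d + 1) L / ((L : ℝ) ^ (k + 1) * (1 / 2)) :=
      div_le_div_of_nonneg_left hsC (mul_pos hM0 (by norm_num)) (mul_le_mul_of_nonneg_left h1θ hM0.le)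
    rw [hQ]
    calc 2 * (bh * ε / (L : ℝ) ^ (k + 1)) + supC (d + 1) L / ((L : ℝ) ^ (k + 1) * (1 - cruxC (d + 1) L * (((L : ℝ) ^ (k + 1)) ^ 2 * (ε / ((L : ℝ) ^ (k + 1)) ^ 2))))
          * (2 * (3 + 12 * ((d + 1 : ℕ) : ℝ)) * bh * ε)
        ≤ 2 * (bh * ε / (L : ℝ) ^ (k + 1)) + supC (d + 1) L / ((L : ℝ) ^ (k + 1) * (1 / 2)) * (2 * (3 + 12 * ((d + 1 : ℕ) : ℝ)) * bh * ε) :=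
          by linarith only [mul_le_mul_of_nonneg_right hfrac hQ0]
      _ = eh * ε / (L : ℝ) ^ (k + 1) := by rw [heh]; field_simp
  have hcE : (ε / ((L : ℝ) ^ (k + 1)) ^ 2 + ε / ((L : ℝ) ^ (k + 1)) ^ 2 + 48 * (2 * (bh * ε / (L : ℝ) ^ (k + 1))) ^ 2)
        + supCurlC (d + 1) L / (((L : ℝ) ^ (k + 1)) ^ 2 * (1 - cruxC (d + 1) L * (((L : ℝ) ^ (k + 1)) ^ 2 * (ε / ((L : ℝ) ^ (k + 1)) ^ 2))))
          * ((3 + 12 * ((d + 1 : ℕ) : ℝ)) * (L : ℝ) ^ (k + 1) * (2 * (bh * ε / (L : ℝ) ^ (k + 1)))) ≤ ch * ε / ((L : ℝ) ^ (k + 1)) ^ 2 := by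
    have hfrac : supCurlC (d + 1) L / (((L : ℝ) ^ (k + 1)) ^ 2 * (1 - cruxC (d + 1) L * (((L : ℝ) ^ (k + 1)) ^ 2 * (ε / ((L : ℝ) ^ (k + 1)) ^ 2))))
        ≤ supCurlC (d + 1) L / (((L : ℝ) ^ (k + 1)) ^ 2 * (1 / 2)) :=
      div_le_div_of_nonneg_left hsCC (mul_pos (pow_pos hM0 2) (by norm_num)) (mul_le_mul_of_nonneg_left h1θ (pow_nonneg hM0.le 2))
    have hsq : 48 * (2 * (bh * ε / (L : ℝ) ^ (k + 1))) ^ 2 = 192 * bh ^ 2 * (ε * ε) / ((L : ℝ) ^ (k + 1)) ^ 2 := by field_simp; ring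
    have hsq' : 192 * bh ^ 2 * (ε * ε) / ((L : ℝ) ^ (k + 1)) ^ 2 ≤ 192 * bh ^ 2 * ε / ((L : ℝ) ^ (k + 1)) ^ 2 := by
      apply div_le_div_of_nonneg_right _ (pow_nonneg hM0.le 2)
      have hεε : ε * ε ≤ ε := mul_le_of_le_one_left hε0 hε1'
      exact mul_le_mul_of_nonneg_left hεε (mul_nonneg (by norm_num) (sq_nonneg bh))
    rw [hQ, hsq]
    calc ε / ((L : ℝ) ^ (k + 1)) ^ 2 + ε / ((L : ℝ) ^ (k + 1)) ^ 2 + 192 * bh ^ 2 * (ε * ε) / ((L : ℝ) ^ (k + 1)) ^ 2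
          + supCurlC (d + 1) L / (((L : ℝ) ^ (k + 1)) ^ 2 * (1 - cruxC (d + 1) L * (((L : ℝ) ^ (k + 1)) ^ 2 * (ε / ((L : ℝ) ^ (k + 1)) ^ 2)))) * (2 * (3 + 12 * ((d + 1 : ℕ) : ℝ)) * bh * ε)
        ≤ ε / ((L : ℝ) ^ (k + 1)) ^ 2 + ε / ((L : ℝ) ^ (k + 1)) ^ 2 + 192 * bh ^ 2 * ε / ((L : ℝ) ^ (k + 1)) ^ 2
          + supCurlC (d + 1) L / (((L : ℝ) ^ (k + 1)) ^ 2 * (1 / 2)) * (2 * (3 + 12 * ((d + 1 : ℕ) : ℝ)) * bh * ε) :=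
          by linarith only [hsq', mul_le_mul_of_nonneg_right hfrac hQ0]
      _ = ch * ε / ((L : ℝ) ^ (k + 1)) ^ 2 := by rw [hch]; field_simp; ring
  have hδ₀ : (eh * ε / (L : ℝ) ^ (k + 1) + (2 * K * (L : ℝ) ^ (k + 1) * (ch * ε / ((L : ℝ) ^ (k + 1)) ^ 2)
          + 8 * K * (((L : ℝ) ^ (k + 1)) ^ 2 * (ε / ((L : ℝ) ^ (k + 1)) ^ 2)) * (frameC (d + 1) L * (L : ℝ) ^ (k + 1) * (eh * ε / (L : ℝ) ^ (k + 1)) + 0) / (L : ℝ) ^ (k + 1)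
          + 16 * K * ((d + 1 : ℕ) : ℝ) * (((L : ℝ) ^ (k + 1)) ^ 2 * (ε / ((L : ℝ) ^ (k + 1)) ^ 2)) * (eh * ε / (L : ℝ) ^ (k + 1))))
        + (frameC (d + 1) L * (L : ℝ) ^ (k + 1) * (eh * ε / (L : ℝ) ^ (k + 1)) + 0) / (L : ℝ) ^ (k + 1) ≤ Cδ * ε / (L : ℝ) ^ (k + 1) := by
    rw [hMx]
    have e1 : (eh * ε / (L : ℝ) ^ (k + 1) + (2 * K * (L : ℝ) ^ (k + 1) * (ch * ε / ((L : ℝ) ^ (k + 1)) ^ 2)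
          + 8 * K * ε * (frameC (d + 1) L * (L : ℝ) ^ (k + 1) * (eh * ε / (L : ℝ) ^ (k + 1)) + 0) / (L : ℝ) ^ (k + 1)
          + 16 * K * ((d + 1 : ℕ) : ℝ) * ε * (eh * ε / (L : ℝ) ^ (k + 1))))
        + (frameC (d + 1) L * (L : ℝ) ^ (k + 1) * (eh * ε / (L : ℝ) ^ (k + 1)) + 0) / (L : ℝ) ^ (k + 1)
        = (eh * ε / (L : ℝ) ^ (k + 1)) * (1 + frameC (d + 1) L + (8 * K * frameC (d + 1) L) * ε + (16 * K * ((d + 1 : ℕ) : ℝ)) * ε)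
          + 2 * K * ch * ε / (L : ℝ) ^ (k + 1) := by
      field_simp; ring
    have e2 : Cδ * ε / (L : ℝ) ^ (k + 1)
        = (eh * ε / (L : ℝ) ^ (k + 1)) * (1 + frameC (d + 1) L + 8 * K * frameC (d + 1) L + 16 * K * ((d + 1 : ℕ) : ℝ)) + 2 * K * ch * ε / (L : ℝ) ^ (k + 1) := by
      rw [hCδ]; field_simp
    rw [e1, e2]
    have heh0 : 0 ≤ eh := by rw [heh]; positivity
    have h0 : 0 ≤ eh * ε / (L : ℝ) ^ (k + 1) := div_nonneg (mul_nonneg heh0 hε0) hM0.le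
    have hin : 1 + frameC (d + 1) L + (8 * K * frameC (d + 1) L) * ε + (16 * K * ((d + 1 : ℕ) : ℝ)) * ε
        ≤ 1 + frameC (d + 1) L + 8 * K * frameC (d + 1) L + 16 * K * ((d + 1 : ℕ) : ℝ) := by
      have a1 : (8 * K * frameC (d + 1) L) * ε ≤ 8 * K * frameC (d + 1) L :=
        mul_le_of_le_one_right (mul_nonneg (mul_nonneg (by norm_num) hK.le) hfC) hε1'
      have a2 : (16 * K * ((d + 1 : ℕ) : ℝ)) * ε ≤ 16 * K * ((d + 1 : ℕ) : ℝ) :=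
        mul_le_of_le_one_right (mul_nonneg (mul_nonneg (by norm_num) hK.le) hdd0) hε1'
      linarith only [a1, a2]
    linarith only [mul_le_mul_of_nonneg_left hin h0]
  have hδmax : 6 * ((d + 1 : ℕ) : ℝ) * (L : ℝ) ^ (k + 1) * (Cδ * ε / (L : ℝ) ^ (k + 1)) ≤ 1 / 10000 := by
    have e : 6 * ((d + 1 : ℕ) : ℝ) * (L : ℝ) ^ (k + 1) * (Cδ * ε / (L : ℝ) ^ (k + 1)) = 6 * ((d + 1 : ℕ) : ℝ) * Cδ * ε := by field_simp
    rw [e]; exact hδmaxline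
  have hMδ : (L : ℝ) ^ (k + 1) * (Cδ * ε / (L : ℝ) ^ (k + 1)) ≤ τ₀ := by
    have e : (L : ℝ) ^ (k + 1) * (Cδ * ε / (L : ℝ) ^ (k + 1)) = Cδ * ε := by field_simp
    rw [e]; exact hCδτ
  have hSsum : 2 * (L : ℝ) ^ (k + 1) * (bh * ε / (L : ℝ) ^ (k + 1)) + 24 * ((d + 1 : ℕ) : ℝ) * (L : ℝ) ^ (k + 1) * (Cδ * ε / (L : ℝ) ^ (k + 1)) ≤ CS * ε := by
    have e : 2 * (L : ℝ) ^ (k + 1) * (bh * ε / (L : ℝ) ^ (k + 1)) + 24 * ((d + 1 : ℕ) : ℝ) * (L : ℝ) ^ (k + 1) * (Cδ * ε / (L : ℝ) ^ (k + 1)) = CS * ε := by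
      rw [hCS]; field_simp
    rw [e]
  have h4 : ((L : ℝ) ^ (k + 1)) ^ 2 * (ε / ((L : ℝ) ^ (k + 1)) ^ 2) ≤ τ₀ := by rw [hMx]; exact hετ
  have hC : 3000000 * (1 + 16 * K) * (1 + ((d + 1 : ℕ) : ℝ)) ^ 3 * (1 + frameC (d + 1) L) * (1 + supC (d + 1) L + supCurlC (d + 1) L) * τ₀ ≤ 1 / 2 := hτ₀C
  obtain ⟨ustar, hlu, hlP, hgl, hXl, hcl, hhl, -, hslice⟩ := hcurved k N W U' (ε / ((L : ℝ) ^ (k + 1)) ^ 2) (ε / ((L : ℝ) ^ (k + 1)) ^ 2) hWu hx hsk hWx hθ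
    hWP hU'u hU'P hθP (by rw [hMx]; exact hεε₁) (by rw [hMx]; exact hε1') hA hθc hx hU'x hτ₀0.le hτ₀1 hτ₀s hC h4 h4 hu₀ hu₀P hpin hb' hb64
    (eE := eh * ε / (L : ℝ) ^ (k + 1)) (cE := ch * ε / ((L : ℝ) ^ (k + 1)) ^ 2) (δ₀ := Cδ * ε / (L : ℝ) ^ (k + 1)) (S := CS * ε)
    heE hcE hδ₀ hδmax hMδ hSsum hS4 hSτ
  exact ⟨hsk, hsk1, hθ, hA, hρline, ustar, hlu, hlP, hgl, hXl, hcl, hhl, hslice⟩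

end

end Summit.QuantumFields.BalabanUV.T4Continuum.NE7SliceRepresentative
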